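import Literature.NumberTheory.Automorphic.CongruenceSubgroupPropertySL2AwayHolds
import HarnessLib

/-!
# Stub 1a of LINE `theoremB-x10b` (crux `PrintX10b.AnalyticMuZeroX10b`, stmt-BirchSwinnertonDyer-20682):
# (V) Vaserstein's relative elementary theorem over `ℤ[1/m]` — now a TREE THEOREM

`stub_vasersteinAway` (registered skeleton sha16 41c1930e4741df0b, lead prover p1 of cell bsd-f3-mu), by NAME and
VERBATIM signature: for `A = ℤ[1/m]` (`Localization.Away (m : ℤ)`, `m ≥ 2`) and every integer `e ≠ 0`,
`G(eA, A) ≤ E(eA, A)` — every `(a b; c d) ∈ SL₂(A)` with `b ≡ 0`, `a ≡ d ≡ 1 (mod e)` is a product of elementary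
matrices `E₁₂(ex)`, `E₂₁(y)` (Vaserstein 1972, Theorem; Bass–Milnor–Serre 1967, Ch. I Thm. 3.6, at the Dedekind ring
of arithmetic type `ℤ[1/m]`).  This was the line's single cite-only input; it is PROVED in the tree by the port of the
`𝓞_K` Vaserstein–Liehl–BMS road to `Localization.Away` (cell bsd-print-x8 seat ty2 g7: files
`CongruenceSubgroupPropertySL2Away{Arith,Lemma4,Lemma2,Symbol,SymbolMul,Holds}.lean`, p570731–p575156; BMS Thm. 3.6 over
`ℤ[1/m]` via quadratic reciprocity: `…AwayMennickeTrivial.lean`, p574472, this seat), exported in exactly this binder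
shape as `Literature.NumberTheory.Automorphic.SL2Rel.Away.relG_le_relE_span_natCast`.  Nothing else is in this file.
-/

namespace Summit.BirchSwinnertonDyer.BirchSwinnertonDyer.Cruxes.AnalyticMuZeroX10b.TheoremB

-- `Summit.<Summit>.<Sub>.…` with Summit = Sub (D-0017): the linter flags it by design
set_option linter.dupNamespace false

/-- **Stub 1a of LINE `theoremB-x10b` — (V)**: Vaserstein's `G(eℤ[1/m], ℤ[1/m]) ≤ E(eℤ[1/m], ℤ[1/m])` for all
`m ≥ 2`, `e ≠ 0`, a theorem of the tree (`SL2Rel.Away.relG_le_relE_span_natCast`).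
[cite: Vaserstein1972SL2, Theorem, p. 313] [cite: BassMilnorSerre1967, Ch. I Thm. 3.6] -/
theorem stub_vasersteinAway :
    ∀ (m : ℕ), 2 ≤ m → ∀ e : ℕ, e ≠ 0 →
      Literature.NumberTheory.Automorphic.SL2Rel.relG (Ideal.span {(e : Localization.Away (m : ℤ))}) ⊤ ≤
        Literature.NumberTheory.Automorphic.SL2Rel.relE (Ideal.span {(e : Localization.Away (m : ℤ))})
          (⊤ : Ideal (Localization.Away (m : ℤ))) :=
  Literature.NumberTheory.Automorphic.SL2Rel.Away.relG_le_relE_span_natCast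

end Summit.BirchSwinnertonDyer.BirchSwinnertonDyer.Cruxes.AnalyticMuZeroX10b.TheoremB
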